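import Literature.NumberTheory.EllipticCurves.CasselsTateGeneralCase
import Literature.NumberTheory.EllipticCurves.SemilinearTateDualPlaces
import Literature.NumberTheory.GaloisCohomology.LocalInvariantMapConjCompatible
import HarnessLib

/-!
# Semilinear transport of the local Cassels–Tate data along an automorphism of `K`

Route `SemiOrdinaryEisensteinDescent` (BSD, rung W-ALL row 2·3@3), Kolyvagin column, print item
`CasselsTateLevelInputsFact` (stmt-20191 ⊂ 25896 `KolyvaginPrimitivesAtThree`): towards conjunct (v) of
`Literature.NumberTheory.EllipticCurves.casselsTate_levelInputs` (the `Aut(K/ℚ)`-invariance of Milne's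
general-case value `ctGeneralFun`) for THE canonical invariant maps `LocalInvariants.canonical`.

For `E = W/ℚ`, `σ ∈ Aut(K/ℚ)`, a lift `τ` of `σ` to `K̄`, a `σ`-semilinear isomorphism `θ : E ≃ E'` of
`K`-fields with a lift `Θ : K̄_E ≃ K̄_{E'}` ADAPTED to `τ` (`LiftsCommute`), and two Weil-type pairings `e`,
`e₂` on `E[m²](K̄)` with `e₂(τS, τT) = τ(e(S, T))`:

* `descendHom_torsionMap` — the descended pairing is semilinear: `desc₂(τx, τy) = τ(desc(x, y))`;
* `locClass₂_cocycle_of_semilinear` — if the fields `β₁, κ, β', ε` of a local datum `L₂` over `E'` (for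
  `e₂`) are the pull-backs `g ↦ τ · C(Θ⁻¹ g Θ)` of those of a local datum `L` over `E` (for `e`), then
  Milne's local `2`-cocycle of `L₂` is the pull-back of that of `L`, hence its class is
  `σ_* [z(L)]` (`semilinearLocalH … 2`);
* `term_canonical_of_semilinear` — at finite places `σ • v = w` of a number field, with the adapted lift
  `liftAutPlace σ h`: **`t_w(L₂) = t_v(L)` for THE invariant maps** (`isConjCompatible_canonical`:
  `inv_w ∘ σ_* = inv_v`).

No named fact, no definition, no curve- or prime-specific statement; BSD is not advanced.

## References

* [MilneADT2006] J. S. Milne, *Arithmetic Duality Theorems*, 2nd ed. (2006), Ch. I §6, proof of Prop. 6.9.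
* [CasselsFrohlichANT1967] Cassels–Fröhlich (eds.), *Algebraic Number Theory* (1967), Ch. VI §1.1 (Serre:
  functoriality of `inv`), Ch. VII §1.1 (Tate: `σ_w : L_w → L_{σw}`).
* [GrossLMS1991] B. H. Gross, *Kolyvagin's work on modular elliptic curves* (1991), §5 (5.1).
-/

noncomputable section

open scoped Classical

-- the Theorems namespace of this sub repeats the summit name by design (D-0017 nested layout)
set_option linter.dupNamespace false
set_option autoImplicit false

universe u

namespace Summit.BirchSwinnertonDyer.BirchSwinnertonDyer.Theorems.CasselsTateConj

open CategoryTheory _root_.WeierstrassCurve Field Function NumberField IsDedekindDomain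
open Literature.NumberTheory.EllipticCurves Literature.NumberTheory.Automorphic
open Literature.NumberTheory.GaloisRepresentations Literature.NumberTheory.GaloisCohomology
open Literature.NumberTheory.GaloisRepresentations.DiscreteGaloisModule (mu MuCarrier pairing)
open scoped ContRepresentation

/-! ## The action of a lift on the torsion levels and on the descended pairing -/

section Torsion

variable {K : Type u} [Field K] [CharZero K] (W : WeierstrassCurve ℚ) (m : ℕ) [NeZero m]
variable {σ : K ≃ₐ[ℚ] K} {τ : AlgebraicClosure K ≃+* AlgebraicClosure K}

omit [NeZero m] in
/-- `ι (τ S) = τ (ι S)` on `E[m] ⊂ E[m²]` (same underlying point). [folklore] -/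
theorem inclKD_torsionMap (hτ : IsLiftOfAut σ τ) (S : geomTorsion (W.baseChange K) (m : ℤ)) :
    inclKD (W.baseChange K) m m (hτ.torsionMap W (m : ℤ) S) =
      hτ.torsionMap W ((m * m : ℕ) : ℤ) (inclKD (W.baseChange K) m m S) :=
  Subtype.ext rfl

omit [NeZero m] in
/-- `[m] (τ S') = τ ([m] S')` on `E[m²]`. [folklore] -/
theorem mulK_torsionMap (hτ : IsLiftOfAut σ τ) (S' : geomTorsion (W.baseChange K) ((m * m : ℕ) : ℤ)) :
    mulK (W.baseChange K) m m (hτ.torsionMap W ((m * m : ℕ) : ℤ) S') =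
      hτ.torsionMap W (m : ℤ) (mulK (W.baseChange K) m m S') := by
  apply Subtype.ext
  rw [coe_mulK_apply, IsLiftOfAut.coe_torsionMap, IsLiftOfAut.coe_torsionMap, coe_mulK_apply, map_zsmul]

omit [NeZero m] in
/-- `ι⁻¹ (τ S') = τ (ι⁻¹ S')` on `E[m²][m]`. [folklore] -/
theorem levelDown_torsionMap (hτ : IsLiftOfAut σ τ) {S' : geomTorsion (W.baseChange K) ((m * m : ℕ) : ℤ)}
    (hS' : mulK (W.baseChange K) m m S' = 0) :
    levelDown (W.baseChange K) m (hτ.torsionMap W ((m * m : ℕ) : ℤ) S') =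
      hτ.torsionMap W (m : ℤ) (levelDown (W.baseChange K) m S') := by
  apply inclKD_injective (W.baseChange K) m
  rw [inclKD_levelDown (W.baseChange K) m (by rw [mulK_torsionMap, hS', map_zero]), inclKD_torsionMap,
    inclKD_levelDown (W.baseChange K) m hS']

variable (e e₂ : geomTorsion (W.baseChange K) ((m * m : ℕ) : ℤ) → geomTorsion (W.baseChange K) ((m * m : ℕ) : ℤ) →
    AlgebraicClosure K)
  (hμ : ∀ S T, e S T ^ (m * m) = 1) (hμ₂ : ∀ S T, e₂ S T ^ (m * m) = 1)
  (hadd₁ : ∀ S₁ S₂ T, e (S₁ + S₂) T = e S₁ T * e S₂ T) (hadd₁₂ : ∀ S₁ S₂ T, e₂ (S₁ + S₂) T = e₂ S₁ T * e₂ S₂ T)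
  (hadd₂ : ∀ S T₁ T₂, e S (T₁ + T₂) = e S T₁ * e S T₂) (hadd₂₂ : ∀ S T₁ T₂, e₂ S (T₁ + T₂) = e₂ S T₁ * e₂ S T₂)

/-- **The descended pairing is semilinear**: if `e₂(τS, τT) = τ(e(S, T))` on `E[m²]` then
`desc₂(τx, τy) = τ(desc(x, y))` on `E[m]` (`desc(x, y) = e(ι x, ỹ)`, and `τ ỹ` is an `m`-th root of `τ y`).
[cite: MilneADT2006, Ch. I §6, proof of Prop. 6.9] -/
theorem descendHom_torsionMap (hτ : IsLiftOfAut σ τ)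
    (he : ∀ S T, e₂ (hτ.torsionMap W _ S) (hτ.torsionMap W _ T) = τ (e S T))
    (x y : geomTorsion (W.baseChange K) (m : ℤ)) :
    descendHom (W.baseChange K) m m e₂ hμ₂ hadd₁₂ hadd₂₂ (hτ.torsionMap W _ x) (hτ.torsionMap W _ y) =
      muSemilinearMap τ (m * m) (descendHom (W.baseChange K) m m e hμ hadd₁ hadd₂ x y) := by
  rw [descendHom_apply_eq (W.baseChange K) m m e₂ hμ₂ hadd₁₂ hadd₂₂ _ _
      (hτ.torsionMap W _ (kRoot (W.baseChange K) m m y)) (by rw [mulK_torsionMap, mulK_kRoot]),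
    descendHom_apply_eq (W.baseChange K) m m e hμ hadd₁ hadd₂ _ _ (kRoot (W.baseChange K) m m y)
      (mulK_kRoot _ _ _ _),
    muCarrier_eq_iff, coe_weilPairingHom, coe_muSemilinearMap, coe_weilPairingHom, inclKD_torsionMap, he]

end Torsion

/-! ## The local cocycle of semilinearly transported local data -/

section Local

variable {K : Type u} [Field K] [NumberField K] (W : WeierstrassCurve ℚ) (m : ℕ) [NeZero m]
variable {E E' : Type u} [Field E] [Algebra K E] [Field E'] [Algebra K E']
variable {σ : K ≃ₐ[ℚ] K} {τ : AlgebraicClosure K ≃+* AlgebraicClosure K} {θ : E ≃+* E'}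
  {Θ : AlgebraicClosure E ≃+* AlgebraicClosure E'}
variable (e e₂ : geomTorsion (W.baseChange K) ((m * m : ℕ) : ℤ) → geomTorsion (W.baseChange K) ((m * m : ℕ) : ℤ) →
    AlgebraicClosure K)
  (hμ : ∀ S T, e S T ^ (m * m) = 1) (hμ₂ : ∀ S T, e₂ S T ^ (m * m) = 1)
  (hadd₁ : ∀ S₁ S₂ T, e (S₁ + S₂) T = e S₁ T * e S₂ T) (hadd₁₂ : ∀ S₁ S₂ T, e₂ (S₁ + S₂) T = e₂ S₁ T * e₂ S₂ T)
  (hadd₂ : ∀ S T₁ T₂, e S (T₁ + T₂) = e S T₁ * e S T₂) (hadd₂₂ : ∀ S T₁ T₂, e₂ S (T₁ + T₂) = e₂ S T₁ * e₂ S T₂)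
  (hgal : ∀ (g : absoluteGaloisGroup K) (S T : geomTorsion (W.baseChange K) ((m * m : ℕ) : ℤ)),
    g • e S T = e (g • S) (g • T))
  (hgal₂ : ∀ (g : absoluteGaloisGroup K) (S T : geomTorsion (W.baseChange K) ((m * m : ℕ) : ℤ)),
    g • e₂ S T = e₂ (g • S) (g • T))

variable {W m e e₂ hμ hμ₂ hadd₁ hadd₁₂ hadd₂ hadd₂₂ hgal hgal₂}

/-- **Semilinearly transported local data have the pulled-back local cocycle.** Let `(τ, Θ)` be adapted
lifts of `(σ, θ)` (`LiftsCommute`), `e₂(τS, τT) = τ(e(S, T))`, and let the local datum `L₂` over `E'` (pairing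
`e₂`) have fields `β₁, κ, β', ε` equal to the pull-backs `g ↦ τ · C(Θ⁻¹ g Θ)` of those of the local datum
`L` over `E` (pairing `e`). Then `z(L₂) = (Θ⁻¹·Θ, τ)^* z(L)` on the nose.
[cite: MilneADT2006, Ch. I §6, proof of Prop. 6.9] [cite: CasselsFrohlichANT1967, Ch. VII §1.1] -/
theorem cocycle_eq_pullback_of_semilinear (hτ : IsLiftOfAut σ τ) (hΘ : IsLiftOfRingEquiv θ Θ)
    (hc : LiftsCommute τ Θ) (he : ∀ S T, e₂ (hτ.torsionMap W _ S) (hτ.torsionMap W _ T) = τ (e S T))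
    {L : GeneralLocalData (W.baseChange K) m E e hμ hadd₁ hadd₂ hgal}
    {L₂ : GeneralLocalData (W.baseChange K) m E' e₂ hμ₂ hadd₁₂ hadd₂₂ hgal₂}
    (hβ₁ : ∀ g, L₂.β₁ g = hτ.torsionMap W _ (L.β₁ (hΘ.conjGalCMH g)))
    (hκ : ∀ g, L₂.κ.1 g = hτ.torsionMap W _ (L.κ.1 (hΘ.conjGalCMH g)))
    (hβ' : ∀ g, L₂.β'.1 g = hτ.torsionMap W _ (L.β'.1 (hΘ.conjGalCMH g)))
    (hε : ∀ g h, L₂.ε (g, h) = muSemilinearMap τ (m * m) (L.ε (hΘ.conjGalCMH g, hΘ.conjGalCMH h))) :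
    L₂.cocycle = contTwoCocycles.pullback hΘ.conjGalCMH
      (semilinearLocalHom (ρ := mu K (m * m)) hτ hΘ hc (muSemilinearMap τ (m * m)) (isSemilinear_mu hτ (m * m)))
      L.cocycle := by
  refine Subtype.ext (ContinuousMap.ext fun p => ?_)
  obtain ⟨g, h⟩ := p
  rw [contTwoCocycles.pullback_apply, semilinearLocalHom_hom_apply, GeneralLocalData.cocycle_apply,
    GeneralLocalData.cocycle_apply, hβ₁, hκ, hβ', hβ', hε, map_mul, ← map_sub, ← map_sub,
    levelDown_torsionMap W m hτ (L.mulK_sub _),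
    descendHom_torsionMap W m e e₂ hμ hμ₂ hadd₁ hadd₁₂ hadd₂ hadd₂₂ hτ he, map_sub]
  exact (map_sub (muSemilinearMap τ (m * m)) _ _).symm

/-- Hence **`[z(L₂)] = σ_* [z(L)]`** in `H²(Γ_{E'}, μ_{m²})`, `σ_* = semilinearLocalH … 2`.
[cite: MilneADT2006, Ch. I §6, proof of Prop. 6.9] [cite: CasselsFrohlichANT1967, Ch. VII §1.1] -/
theorem locClass₂_cocycle_of_semilinear (hτ : IsLiftOfAut σ τ) (hΘ : IsLiftOfRingEquiv θ Θ)
    (hc : LiftsCommute τ Θ) (he : ∀ S T, e₂ (hτ.torsionMap W _ S) (hτ.torsionMap W _ T) = τ (e S T))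
    {L : GeneralLocalData (W.baseChange K) m E e hμ hadd₁ hadd₂ hgal}
    {L₂ : GeneralLocalData (W.baseChange K) m E' e₂ hμ₂ hadd₁₂ hadd₂₂ hgal₂}
    (hβ₁ : ∀ g, L₂.β₁ g = hτ.torsionMap W _ (L.β₁ (hΘ.conjGalCMH g)))
    (hκ : ∀ g, L₂.κ.1 g = hτ.torsionMap W _ (L.κ.1 (hΘ.conjGalCMH g)))
    (hβ' : ∀ g, L₂.β'.1 g = hτ.torsionMap W _ (L.β'.1 (hΘ.conjGalCMH g)))
    (hε : ∀ g h, L₂.ε (g, h) = muSemilinearMap τ (m * m) (L.ε (hΘ.conjGalCMH g, hΘ.conjGalCMH h))) :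
    locClass₂ _ E' L₂.cocycle =
      semilinearLocalH (ρ := mu K (m * m)) hτ hΘ hc (muSemilinearMap τ (m * m)) (isSemilinear_mu hτ (m * m)) 2
        (locClass₂ _ E L.cocycle) := by
  haveI : CompactSpace (absoluteGaloisGroup E) := absoluteGaloisGroup_compactSpace E
  haveI : CompactSpace (absoluteGaloisGroup E') := absoluteGaloisGroup_compactSpace E'
  rw [locClass₂_eq, locClass₂_eq,
    cocycle_eq_pullback_of_semilinear hτ hΘ hc he hβ₁ hκ hβ' hε]
  exact (map_twoCocycleClass _ _ _ _).symm

end Local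

/-! ## At the finite places of a number field: the local term for THE invariant maps -/

section Places

-- `K : Type`: the universe of `LocalInvariantMapConjCompatible` (`isConjCompatible_canonical`)
variable {K : Type} [Field K] [NumberField K] (W : WeierstrassCurve ℚ) (m : ℕ) [NeZero m] (σ : K ≃ₐ[ℚ] K)
variable (e e₂ : geomTorsion (W.baseChange K) ((m * m : ℕ) : ℤ) → geomTorsion (W.baseChange K) ((m * m : ℕ) : ℤ) →
    AlgebraicClosure K)
  (hμ : ∀ S T, e S T ^ (m * m) = 1) (hμ₂ : ∀ S T, e₂ S T ^ (m * m) = 1)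
  (hadd₁ : ∀ S₁ S₂ T, e (S₁ + S₂) T = e S₁ T * e S₂ T) (hadd₁₂ : ∀ S₁ S₂ T, e₂ (S₁ + S₂) T = e₂ S₁ T * e₂ S₂ T)
  (hadd₂ : ∀ S T₁ T₂, e S (T₁ + T₂) = e S T₁ * e S T₂) (hadd₂₂ : ∀ S T₁ T₂, e₂ S (T₁ + T₂) = e₂ S T₁ * e₂ S T₂)
  (hgal : ∀ (g : absoluteGaloisGroup K) (S T : geomTorsion (W.baseChange K) ((m * m : ℕ) : ℤ)),
    g • e S T = e (g • S) (g • T))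
  (hgal₂ : ∀ (g : absoluteGaloisGroup K) (S T : geomTorsion (W.baseChange K) ((m * m : ℕ) : ℤ)),
    g • e₂ S T = e₂ (g • S) (g • T))

variable {W m e e₂ hμ hμ₂ hadd₁ hadd₁₂ hadd₂ hadd₂₂ hgal hgal₂}

/-- **Transport of the local term at the finite places, for THE invariant maps.** At a place datum
`h : σ • v = w` with the adapted lift `τ = liftAutPlace σ h` of `σ` and the Galois transport of completions
`K_v ≃ K_w`: if the local datum `L₂` at `w` (pairing `e₂`, `e₂(τS, τT) = τ e(S, T)`) has fields `β₁, κ, β', ε`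
pulled back from those of the local datum `L` at `v` (pairing `e`), then
`t_w(L₂) = inv_w [z(L₂)] = inv_w (σ_* [z(L)]) = inv_v [z(L)] = t_v(L)` for `inv = LocalInvariants.canonical`
(`isConjCompatible_canonical`). [cite: CasselsFrohlichANT1967, Ch. VI §1.1 and Ch. VII §1.1]
[cite: MilneADT2006, Ch. I §6, proof of Prop. 6.9] -/
theorem term_canonical_of_semilinear {v w : HeightOneSpectrum (𝓞 K)} (h : σ • v = w)
    (he : ∀ S T, e₂ ((isLiftOfAut_liftAutPlace σ h).torsionMap W _ S)
      ((isLiftOfAut_liftAutPlace σ h).torsionMap W _ T) = liftAutPlace σ h (e S T))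
    {L : GeneralLocalData (W.baseChange K) m (v.adicCompletion K) e hμ hadd₁ hadd₂ hgal}
    {L₂ : GeneralLocalData (W.baseChange K) m (w.adicCompletion K) e₂ hμ₂ hadd₁₂ hadd₂₂ hgal₂}
    (hβ₁ : ∀ g, L₂.β₁ g = (isLiftOfAut_liftAutPlace σ h).torsionMap W _
      (L.β₁ ((isLiftOfRingEquiv_ringEquivLift (galAdicCompletionEquiv (L := K) σ h)).conjGalCMH g)))
    (hκ : ∀ g, L₂.κ.1 g = (isLiftOfAut_liftAutPlace σ h).torsionMap W _
      (L.κ.1 ((isLiftOfRingEquiv_ringEquivLift (galAdicCompletionEquiv (L := K) σ h)).conjGalCMH g)))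
    (hβ' : ∀ g, L₂.β'.1 g = (isLiftOfAut_liftAutPlace σ h).torsionMap W _
      (L.β'.1 ((isLiftOfRingEquiv_ringEquivLift (galAdicCompletionEquiv (L := K) σ h)).conjGalCMH g)))
    (hε : ∀ g g', L₂.ε (g, g') = muSemilinearMap (liftAutPlace σ h) (m * m)
      (L.ε ((isLiftOfRingEquiv_ringEquivLift (galAdicCompletionEquiv (L := K) σ h)).conjGalCMH g,
        (isLiftOfRingEquiv_ringEquivLift (galAdicCompletionEquiv (L := K) σ h)).conjGalCMH g'))) :
    L₂.term (LocalInvariants.canonical K (m * m) (Sum.inr w : Place K)) =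
      L.term (LocalInvariants.canonical K (m * m) (Sum.inr v : Place K)) := by
  have key := locClass₂_cocycle_of_semilinear (isLiftOfAut_liftAutPlace σ h)
    (isLiftOfRingEquiv_ringEquivLift (galAdicCompletionEquiv (L := K) σ h)) (liftsCommute_liftAutPlace σ h)
    he hβ₁ hκ hβ' hε
  have hcc := isConjCompatible_canonical σ (m * m) v w h
    (locClass₂ (mu K (m * m)) (v.adicCompletion K) L.cocycle)
  unfold GeneralLocalData.term
  rw [key]
  exact hcc

end Places

end Summit.BirchSwinnertonDyer.BirchSwinnertonDyer.Theorems.CasselsTateConj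

end
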